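import Literature.AlgebraicGeometry.AbelianSchemes.PoincareUniversalLocality
import Literature.AlgebraicGeometry.AbelianSchemes.AbelianSchemeDualTransport
import HarnessLib

/-!
# Uniqueness half of the universal property of the dual pair descended along a free finite quotient of the base
# ([Mumford AV] §13 p. 125 «unique»; [Milne AV] I §8; fpqc descent of morphisms [GW] Thm. 14.72)

Topic `AlgebraicGeometry/AbelianSchemes`; namespace `Literature.AlgebraicGeometry.AbelianSchemes.AbelianSchemeOver`.
THEOREMS ONLY (no definition, no named fact, no instance, no notation, no `sorry`; net Literature debt 0).
Cell hodgecm-mathlib (D-0151), F-DAG price sheet leaf F-10 (10a), the DUAL-PAIR instalment, part 3 (after ★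
`PoincareBaseQuotientDescent` — a rigidified line bundle `𝒫_B` on `B ×_Q B̂` with `(π ×_p π̂)^*𝒫_B ≅ 𝒫` — and ★/HOME
`PoincareBaseQuotientDescentPicZero` — clause (a)): for ANY module `P′` on `B ×_Q B̂` with `(π ×_p π̂)^* P′ ≅ 𝒫`,
**two `Q`-morphisms `g₁, g₂ : T → B̂` with `(1_B × g₁)^* P′ ≅ (1_B × g₂)^* P′` are EQUAL** — the «unique» of ★
`DualPair.universal` for `(B̂, P′)` over `Q`, for every test scheme `T` (no reducedness, no Noetherian hypothesis).
HC_CM is proved only modulo the 7 printed citations until rung 0 closes; this file discharges none of them.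

SETTING.  `p : S → Q` an fpqc cover (surjective, flat, quasi-compact — e.g. a finite étale quotient map); `A` an
abelian scheme over `S` with a dual pair `D = (Â, 𝒫)`; `B`, `B̂` abelian schemes over `Q`; `π : A → B`, `π̂ : Â → B̂`
exhibiting `A`, `Â` as the base changes of `B`, `B̂` along `p` as group schemes (★ `IsBaseChangeVia`); `P′` a module on
`B ×_Q B̂` with `ϖ^* P′ ≅ 𝒫`, `ϖ := π ×_p π̂` (`pullback.map`).  No group action is needed here.

PROOF ([MumfordAV1970] §13's uniqueness, run on the cover).  Given `f : T → Q` and `gᵢ : T → B̂` over `f`, put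
`T′ := T ×_Q S` with projections `c : T′ → T`, `f′ : T′ → S`; since `Â = B̂ ×_Q S` (the cartesian square of `hÂB̂`) the
maps `c ≫ gᵢ` LIFT to `lᵢ : T′ → Â` over `f′`.  The square `(1_A × lᵢ) ≫ ϖ = κ ≫ (1_B × gᵢ)` with
`κ : A_{T′} = A ×_S T′ → B ×_Q T = B_T` (§1) gives `(1_A × lᵢ)^*𝒫 ≅ κ^*(1_B × gᵢ)^*P′`, so `(1_A × l₁)^*𝒫 ≅ (1_A × l₂)^*𝒫`;
both `lᵢ` classify the rigidified `Pic⁰` family `(1_A × l₁)^*𝒫` on `A_{T′}` (★ `RigidifiedLineBundle.comapAlong` of ★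
`selfBundle D`), hence `l₁ = l₂` by the uniqueness in `D.universal` (★ `DualPair.eq_of_nonempty_iso`); therefore
`c ≫ g₁ = l₁ ≫ π̂ = l₂ ≫ π̂ = c ≫ g₂`, and `c` is an epimorphism of schemes (a base change of the fpqc cover `p`;
Mathlib: surjective + flat + quasi-compact ⇒ `Epi`).

* §1 `baseChangeToProd_comp_prodQuotientMap`, `nonempty_pullbackP_iso_pullback_pullback_baseChangeToProd` — the
  square and the module isomorphism `(1_A × l)^*𝒫 ≅ κ^*(1_B × g)^*P′` for any lift `l` of `c ≫ g`;
* §2 **`eq_of_pullback_baseChangeToProd_iso_of_base_quotient`** — THE HEAD.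

Mathlib searched (pin): `IsPullback.lift(_fst/_snd)`, `MorphismProperty.pullback_fst` (`Surjective`, `Flat`,
`QuasiCompact`), `AlgebraicGeometry.Flat.epi_of_flat_of_surjective` (instance `Epi`), `cancel_epi` (all used).

## References
* D. Mumford, *Abelian Varieties* (1970), §13 (Thm. p. 125 and its proof: «unique»). [MumfordAV1970]
* J. S. Milne, *Abelian Varieties* (v2.00, 2008), I §8 pp. 36–37. [MilneAV2008]
* U. Görtz, T. Wedhorn, *Algebraic Geometry I*, 2nd ed. (2020), Thm. 14.72 (fpqc descent of morphisms), Section (4.7)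
  (pp. 107–108). [GortzWedhorn2020]
* D. Mumford, J. Fogarty, F. Kirwan, *Geometric Invariant Theory*, 3rd ed. (1994), Ch. 7 §3, remark after Thm. 7.9 and
  Lemma 7.11 (pp. 139–140). [MumfordFogartyKirwan1994]
-/

noncomputable section

universe u

open CategoryTheory Limits AlgebraicGeometry MonoidalCategory CartesianMonoidalCategory MonObj

namespace Literature.AlgebraicGeometry.AbelianSchemes.AbelianSchemeOver

open Literature.AlgebraicGeometry.Modules Literature.AlgebraicGeometry.Motives
  Literature.AlgebraicGeometry.AbelianVarieties

set_option backward.isDefEq.respectTransparency false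

variable {S Q : Scheme.{u}} {p : S ⟶ Q}
  (A : AbelianSchemeOver S) (D : A.DualPair)
  (B : AbelianSchemeOver Q) {π : A.X.left ⟶ B.X.left} (hAB : A.IsBaseChangeVia B p π)
  (Bh : AbelianSchemeOver Q) {πh : D.hat.X.left ⟶ Bh.X.left} (hABh : D.hat.IsBaseChangeVia Bh p πh)
  (P' : (B.prodLeft Bh).Modules)

/-! ### §1 The comparison square for a lifted test morphism -/

/-- **`(1_A × l) ≫ ϖ = κ ≫ (1_B × g)`** for `g : T → B̂` over `f : T → Q`, any `T′` with `c : T′ → T`, `f′ : T′ → S`,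
`f′ ≫ p = c ≫ f`, and a LIFT `l : T′ → Â` of `c ≫ g` over `f′`; here `κ = π ×_p c : A ×_S T′ → B ×_Q T`
(`pullback.map`). [cite: GortzWedhorn2020, Section (4.7) (pp. 107–108)] [cite: MilneAV2008, I §8 pp. 36–37] -/
theorem baseChangeToProd_comp_prodQuotientMap {T T' : Scheme.{u}} (f : T ⟶ Q) (c : T' ⟶ T) (f' : T' ⟶ S)
    (hc : f' ≫ p = c ≫ f) (g : T ⟶ Bh.X.left) (hg : g ≫ Bh.X.hom = f) (g' : T' ⟶ D.hat.X.left)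
    (hg' : g' ≫ D.hat.X.hom = f') (hlift : g' ≫ πh = c ≫ g) :
    A.baseChangeToProd D.hat f' g' hg' ≫
        pullback.map A.X.hom D.hat.X.hom B.X.hom Bh.X.hom π πh p hAB.fst.symm hABh.fst.symm =
      pullback.map A.X.hom f' B.X.hom f π c p hAB.fst.symm hc ≫ B.baseChangeToProd Bh f g hg := by
  apply pullback.hom_ext
  · rw [Category.assoc, pullback.lift_fst, baseChangeToProd_fst_assoc, Category.assoc, baseChangeToProd_fst,
      pullback.lift_fst]
  · rw [Category.assoc, pullback.lift_snd, baseChangeToProd_snd_assoc, Category.assoc, baseChangeToProd_snd,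
      pullback.lift_snd_assoc, Category.assoc, hlift]

/-- **Hence `(1_A × l)^* 𝒫 ≅ κ^* (1_B × g)^* P′`** whenever `ϖ^* P′ ≅ 𝒫` (★ `DualPair.pullbackP` on the left).
[cite: MilneAV2008, I §8 pp. 36–37] [cite: GortzWedhorn2020, Section (4.7) (pp. 107–108)] -/
theorem nonempty_pullbackP_iso_pullback_pullback_baseChangeToProd
    (eP : Nonempty ((Scheme.Modules.pullback
      (pullback.map A.X.hom D.hat.X.hom B.X.hom Bh.X.hom π πh p hAB.fst.symm hABh.fst.symm)).obj P' ≅ D.P))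
    {T T' : Scheme.{u}} (f : T ⟶ Q) (c : T' ⟶ T) (f' : T' ⟶ S)
    (hc : f' ≫ p = c ≫ f) (g : T ⟶ Bh.X.left) (hg : g ≫ Bh.X.hom = f) (g' : T' ⟶ D.hat.X.left)
    (hg' : g' ≫ D.hat.X.hom = f') (hlift : g' ≫ πh = c ≫ g) :
    Nonempty (D.pullbackP f' g' hg' ≅
      (Scheme.Modules.pullback (pullback.map A.X.hom f' B.X.hom f π c p hAB.fst.symm hc)).obj
        ((Scheme.Modules.pullback (B.baseChangeToProd Bh f g hg)).obj P')) := by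
  obtain ⟨e⟩ := eP
  exact ⟨(Scheme.Modules.pullback (A.baseChangeToProd D.hat f' g' hg')).mapIso e.symm ≪≫
    (Scheme.Modules.pullbackComp _ _).app P' ≪≫
    (Scheme.Modules.pullbackCongr
      (baseChangeToProd_comp_prodQuotientMap A D B hAB Bh hABh f c f' hc g hg g' hg' hlift)).app P' ≪≫
    ((Scheme.Modules.pullbackComp _ _).app P').symm⟩

/-! ### §2 Uniqueness of the classifying morphism over `Q` -/

/-- **UNIQUENESS HALF OF THE UNIVERSAL PROPERTY OF THE DESCENDED DUAL PAIR.**  In the SETTING of the module docstring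
(`p : S → Q` surjective, flat, quasi-compact; `A`, `Â` the base changes of `B`, `B̂` along `p`; `ϖ^* P′ ≅ 𝒫`): for every
test scheme `T`, `f : T → Q` and `Q`-morphisms `g₁, g₂ : T → B̂` over `f` with `(1_B × g₁)^* P′ ≅ (1_B × g₂)^* P′`, one
has `g₁ = g₂` — the «unique» of ★ `DualPair.universal` for `(B̂, P′)`.  (Lift `c ≫ gᵢ` along `Â = B̂ ×_Q S` to
`lᵢ : T ×_Q S → Â`; both classify `(1_A × l₁)^*𝒫`, so `l₁ = l₂` by the uniqueness in `D.universal`; and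
`c : T ×_Q S → T` is an epimorphism.) [cite: MumfordAV1970, §13 (p. 125)] [cite: MilneAV2008, I §8 pp. 36–37]
[cite: GortzWedhorn2020, Thm. 14.72] [cite: MumfordFogartyKirwan1994, Ch. 7 §3, remark after Thm. 7.9 and Lemma 7.11 (pp. 139–140)] -/
theorem eq_of_pullback_baseChangeToProd_iso_of_base_quotient [Surjective p] [Flat p] [QuasiCompact p]
    (eP : Nonempty ((Scheme.Modules.pullback
      (pullback.map A.X.hom D.hat.X.hom B.X.hom Bh.X.hom π πh p hAB.fst.symm hABh.fst.symm)).obj P' ≅ D.P))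
    {T : Scheme.{u}} (f : T ⟶ Q) (g₁ g₂ : T ⟶ Bh.X.left) (hg₁ : g₁ ≫ Bh.X.hom = f) (hg₂ : g₂ ≫ Bh.X.hom = f)
    (h : Nonempty ((Scheme.Modules.pullback (B.baseChangeToProd Bh f g₁ hg₁)).obj P' ≅
      (Scheme.Modules.pullback (B.baseChangeToProd Bh f g₂ hg₂)).obj P')) :
    g₁ = g₂ := by
  obtain ⟨i⟩ := h
  -- the test scheme `T′ = T ×_Q S` over `S`
  let c : pullback f p ⟶ T := pullback.fst f p
  let f' : pullback f p ⟶ S := pullback.snd f p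
  have hc : f' ≫ p = c ≫ f := pullback.condition.symm
  -- the lifts `gᵢ♯ : T′ → Â` of `c ≫ gᵢ` (`Â = B̂ ×_Q S`)
  have hsq : ∀ (g : T ⟶ Bh.X.left) (hg : g ≫ Bh.X.hom = f), (c ≫ g) ≫ Bh.X.hom = f' ≫ p := fun g hg => by
    rw [Category.assoc, hg, hc]
  let l₁ : pullback f p ⟶ D.hat.X.left := hABh.snd.1.lift (c ≫ g₁) f' (hsq g₁ hg₁)
  let l₂ : pullback f p ⟶ D.hat.X.left := hABh.snd.1.lift (c ≫ g₂) f' (hsq g₂ hg₂)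
  have hl₁ : l₁ ≫ πh = c ≫ g₁ := hABh.snd.1.lift_fst _ _ _
  have hl₂ : l₂ ≫ πh = c ≫ g₂ := hABh.snd.1.lift_fst _ _ _
  have hl₁' : l₁ ≫ D.hat.X.hom = f' := hABh.snd.1.lift_snd _ _ _
  have hl₂' : l₂ ≫ D.hat.X.hom = f' := hABh.snd.1.lift_snd _ _ _
  -- `(1_A × lᵢ)^* 𝒫 ≅ κ^* (1_B × gᵢ)^* P′`, so the two agree
  obtain ⟨j₁⟩ := nonempty_pullbackP_iso_pullback_pullback_baseChangeToProd A D B hAB Bh hABh P' eP f c f' hc g₁ hg₁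
    l₁ hl₁' hl₁
  obtain ⟨j₂⟩ := nonempty_pullbackP_iso_pullback_pullback_baseChangeToProd A D B hAB Bh hABh P' eP f c f' hc g₂ hg₂
    l₂ hl₂' hl₂
  -- the rigidified `Pic⁰` family `(1_A × l₁)^* 𝒫` on `A_{T′}`, classified by both `l₁` and `l₂`
  let ℒ : A.RigidifiedLineBundle f' := (DualPair.selfBundle D).comapAlong l₁ hl₁'
  have hℒ : ℒ.FibrewisePicZero :=
    RigidifiedLineBundle.comapAlong_fibrewisePicZero (DualPair.selfBundle_fibrewisePicZero D) l₁ hl₁'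
  have key : l₁ = l₂ :=
    D.eq_of_nonempty_iso f' ℒ hℒ l₁ l₂ hl₁' hl₂' ⟨Iso.refl _⟩
      ⟨j₂ ≪≫ (Scheme.Modules.pullback _).mapIso i.symm ≪≫ j₁.symm⟩
  -- conclude: `c ≫ g₁ = c ≫ g₂` and `c` is an epimorphism (fpqc cover)
  haveI : Surjective c := MorphismProperty.pullback_fst _ _ inferInstance
  haveI : Flat c := MorphismProperty.pullback_fst _ _ inferInstance
  haveI : QuasiCompact c := MorphismProperty.pullback_fst _ _ inferInstance
  haveI : Epi c := inferInstance
  rw [← cancel_epi c, ← hl₁, ← hl₂, key]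

end Literature.AlgebraicGeometry.AbelianSchemes.AbelianSchemeOver

end
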